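import Summits.ResolutionOfSingularities.ResolutionOfSingularities.Theorems.HilbertSamuelEliminationSigmaMaxModificationsCorridor3WLadderLocalChainsTowers
import Summits.ResolutionOfSingularities.ResolutionOfSingularities.Theorems.PurelyInseparableDim4RidgeResidual
import HarnessLib

/-!
# F4-I(3,3) from Cossart–Jannsen–Saito: `E2(3,3)` (= `NoWideTrap 3 3`) and `NoIsolatedTrap 3 3` from the
# NAMED FACT «CJS LNM 2270 Thm. 6.40, unit-wise localised, isolated form», MODULO ONE transfer row
# (cell `res-dim4-pi`, WORD #40 (a): the CJS-DICTIONARY brick, F4-I(3,3) second prover hand)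

[OURS · counted 0 · AI work weaker than expert review.]  Cell `res-dim4-pi` (D-0157 DOOR 2), seat
`res-dim4-p-2` g2, K-read by res-dim4-p-9.  NOTHING here proves `NoIsolatedTrap 3 3`, `NoWideTrap 3 3`, the
Cossart–Jannsen–Saito theorem, or resolution of singularities in dimension ≥ 4 / characteristic `p`.

## The shape of the face after p660329 / p661515

`NoIsolatedTrap 3 3 ↔ NoWideTrap 3 3` (`RidgeBudget.noIsolatedTrap_three_three_iff_noWideTrap`, res-dim4-p-12 g2)
and `NoWideTrap 3 3 ↔` «no infinite ISOLATED `Step0 3` chain with `ord₀ F ≡ 3` and `ebar F ≡ 2`»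
(`RidgeBudget.noWideTrap_iff_coneTwo`; `ebar F = dim_K A(in₃ F)` the additive subspace of the initial form =
`ē` of the point) — «E2(3,3)», the `e = ē = 2` cone, the territory of [CJS 2020] Thm. 5.40 = LNM 2270
Thm. 6.40: no infinite chain of fundamental units with (quasi-)isolated initial parts, under the book's
standing assumption (F1) «`char k(x) = 0 ∨ char k(x) ≥ dim X/2 + 1`», which HOLDS for our 4-folds
`z³ + F(x₁,…,x₄) = 0` at `p = 3` (`4 + 2 ≤ 2·3`, `charHypothesis_of_dim_four_char_three`) and FAILS at
`p = 2` (`not_charHypothesis_of_dim_four_char_two`) — the formal reason (3,3) is CJS territory and (2,2)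
needed the tree's own theorem (p653326).

## What is proved here (sorry-free; one OURS row as hypothesis, one NAMED FACT as hypothesis)

* The tree's named fact is `KeyTheorem640_char_localized_isolated` (`Literature/…/CossartJannsenSaito2020/
  KeyTheoremsLocal.lean`: Thm. 6.40 with (F1), chains of fundamental units localised unit by unit as p. 107
  directs, initial points isolated in the Hilbert–Samuel locus).  Cell res-hironaka's W4.2 H-layer PROVED
  the packaging this brick needs, dimension-free: **`LocalChains.false_of_units_chain`**
  (`…Corridor3WLadderLocalChainsTowers`): an infinite chain `(S_i, s_i)` of blow-ups of the closed point of
  LOCAL schemes followed to CLOSED NEAR points (same Hilbert–Samuel function), with `e = ē = 2` at every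
  node, every `s_i` isolated in `(S_i)_max`, `S_0` excellent of dimension `≤ N` under (F1), IS a unit-wise
  localised chain of LENGTH-ONE fundamental units (Def. 6.38 «by convention …», Def. 6.39), which the named
  fact forbids.  REUSED, not restated.
* §1 `charHypothesis_of_dim_four_char_three`, `not_charHypothesis_of_dim_four_char_two` — (F1) in our regime.
* §2 **THE TRANSFER ROW `IsolatedConeTwoChainLocalizes`** (OURS; a parameterless `Prop`, deliberately
  untagged so that the gate does not relocate it — precedent W4.2 `MovingLineageLocalizesM` p512269): every
  E2-violating frame chain over a field of characteristic `3` LOCALISES to such a chain of local schemes —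
  its body is VERBATIM the list of non-CJS hypotheses of `false_of_units_chain`, existentially packaged.  This
  row IS the scheme-level dictionary debt of the brick, as ONE Lean signature: (local hypersurface model of
  each state `z³ + F_k` at the origin — typ-3's `PointStep*` INVARIANT is the point-centre chart side;
  «near» ⟺ multiplicity `3` again; `e = ē = 2` ⟺ `ebar = 2` over a perfect closure; HS-isolation ⟺
  `IsIsolated 3`; excellence, `dim = 4`, (F1)).  NOT proved here; sub-rows to be split off and discharged.
* §3 **`noWideTrap_three_of_CJS : KeyTheorem640_char_localized_isolated → IsolatedConeTwoChainLocalizes →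
  NoWideTrap 3 3`** and **`noIsolatedTrap_three_three_of_CJS : … → NoIsolatedTrap 3 3`**:
  F4-I(3,3) = [CJS Thm. 6.40 ‖ named fact, [DIM4 · CJS-ROW]] ∧ [ONE OURS transfer row].

bears_on: LADDER-RESOLUTION:D157-DOOR2 (res-dim4-pi · F4-I(3,3) · CJS dictionary).  Supports
stmt-ResolutionOfSingularities-16155 (helper).
-/

set_option linter.dupNamespace false -- mandated namespace of this single-conjunct summit

noncomputable section

open CategoryTheory AlgebraicGeometry TopologicalSpace IsLocalRing
open Literature.AlgebraicGeometry.Resolution Literature.RingTheory.HilbertSamuel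
open Literature.AlgebraicGeometry.Resolution.Hauser2010
open Literature.AlgebraicGeometry.CossartJannsenSaito2020
open Scheme.IdealSheafData

namespace Summit.ResolutionOfSingularities.ResolutionOfSingularities.Theorems.PIDim4

namespace E2OfCJS

open RidgeBudget (NoWideTrap ebar noWideTrap_iff_coneTwo noIsolatedTrap_three_three_iff_noWideTrap)
open SigmaMaxModificationsCorridor3.Moving.LocalChains (false_of_units_chain)

universe u

/-! ## §1 The standing assumption (F1) of the Key Theorems in OUR regime -/

/-- **(F1) HOLDS for a 4-dimensional scheme at a point of residue characteristic `3`**: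
`dim X + 2 = 6 ≤ 2·3` («`char k(x) ≥ dim X/2 + 1`», [CJS 2020] Thm. 10.2 / Ch. 12 opening) — the reason
F4-I(3,3) lies in the range of Thm. 6.40. [cite: CossartJannsenSaito2020, Thm. 10.2] -/
theorem charHypothesis_of_dim_four_char_three {X : Scheme.{u}} (x : X)
    (hd : topologicalKrullDim ↥X = (4 : WithBot ℕ∞))
    (hc : ringChar (ResidueField (X.presheaf.stalk x)) = 3) : CharHypothesis X x :=
  ⟨4, by exact_mod_cast hd, Or.inr (by rw [hc])⟩

/-- **(F1) FAILS for a 4-dimensional scheme at a point of residue characteristic `2`** (`6 ≤ 4` is false):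
the Key Theorems as printed say nothing at (2,2) — where the cell proved `NoIsolatedTrap 2 2` itself
(p653326). [cite: CossartJannsenSaito2020, Thm. 10.2] -/
theorem not_charHypothesis_of_dim_four_char_two {X : Scheme.{u}} (x : X)
    (hd : topologicalKrullDim ↥X = (4 : WithBot ℕ∞))
    (hc : ringChar (ResidueField (X.presheaf.stalk x)) = 2) : ¬ CharHypothesis X x := by
  rintro ⟨d, hd', hor⟩
  rw [hd] at hd'
  have hd4 : d = 4 := by
    have h : ((d : ℕ∞) : WithBot ℕ∞) = ((4 : ℕ∞) : WithBot ℕ∞) := by exact_mod_cast hd'.symm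
    exact_mod_cast h
  rw [hc, hd4] at hor
  omega

/-! ## §2 The transfer row (OURS): an E2-violating frame chain localises to a chain of local schemes -/

/-- [OURS · res-dim4-pi · F4-I(3,3) · CJS dictionary] **TRANSFER ROW — AN E2-VIOLATING FRAME CHAIN LOCALISES.**
For every field `K` of characteristic `3` and every infinite chain `c` of the frame's point blow-ups
(`Step0 3`) with every state ISOLATED `3`-fold, of residual order EXACTLY `3` and with `ebar = 2` (the
additive subspace of the initial form two-dimensional — `ē = 2`), there are: a level `N`, local schemes
`S_i` (locally noetherian; `S_0` local at `s_0`, excellent, of dimension `≤ N`, satisfying (F1) at `s_0`),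
blow-ups `π_i : B_i ⟶ S_i` of the (reduced, permissible) closed points `s_i`, CLOSED points `b_i ∈ B_i`
over `s_i` with the SAME Hilbert–Samuel function (near), `(S_{i+1}, s_{i+1})` the local scheme of `B_i` at
`b_i`, with `e = ē = 2` at every `s_i` and every `b_i` and every `s_i` isolated in the Hilbert–Samuel locus
of `S_i` — VERBATIM the non-CJS hypotheses of res-hironaka's `LocalChains.false_of_units_chain`, with the
level `N` existential (any `N ≥ dim S_0 = 4` will do).  PERFECTNESS (res-dim4-p-9 K-SIG-P2 (P1)): the row
quantifies over EVERY field `K` of characteristic `3` (as `NoWideTrap 3 3` does) but only asks for the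
EXISTENCE of the local schemes; the INTENDED WITNESS is the hypersurface `z³ + F` over a PERFECT CLOSURE (or
an algebraic closure) of `K` — the frame's cleaning `deletePthPowers` is the coordinate change
`z ↦ z − Σ c_e^{1/3} x^e` only when the deleted coefficients are cubes — and `S_0` is deliberately NOT tied
to `Spec K[x,z]/(z³ + F)` over `K` itself.  DISCHARGE PLAN (the sub-rows this row packages; none is proved
here): (L-D0) the frame letters `ordZero`, `ebar`, `IsIsolated 3`, `IsEquimultiplePoint`, `Step0 3` are
invariant under `MvPolynomial.map (algebraMap K K^perf)` (elementary but not free: `IsIsolated` is about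
minimal primes; cf. p-14 `IsolatedChainBaseChange`); (M) LOCAL HYPERSURFACE MODEL: `S_i = Spec 𝒪_{X_i, 0}`,
`X_i : z³ + F_i = 0` in `𝔸⁵`, the blow-up of its closed point and the next local scheme read through
typ-3's `PointStepLocal/Chart/Package` INVARIANT (open-immersion chart `φ : 𝔸⁵ ⟶ Z`, `M.ideal.comap φ =
hypSheaf 3 F`; blow-up commutes with localisation, translation to `b`, the cleaning automorphism), the closed
point of a local scheme is point-permissible (Hilbert–Samuel semicontinuity); (N) NEAR ⟺ multiplicity `3`
again: the Hilbert–Samuel function of a hypersurface point in a regular `5`-dimensional ambient is a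
function of the multiplicity alone ⟸ frame `IsEquimultiplePoint` (CJS Ch. 2); (E) `e = ē = 2` ⟺ `ebar = 2`:
`Dir` of the cone `z³ + Φ` is `A(Φ)` through `v ↦ ((−Φ(v))^{1/3}, v)`, `K`-linear on `A(Φ)` over a perfect `K`
(`PointBlowup.additiveSubspace`, CJS Def. 2.18/2.21/2.26; res-dim4-p-5 g2 offered the identity); (I)
HS-ISOLATION ⟺ `IsIsolated 3 F_i`: the `3`-fold locus of `z³ + F` projects onto `V(J₃⁺(F))` (T-ISO-1,
`…Scope` docstring; perfect `K`); (X) `𝒪_{X,0}` excellent (localised finite-type algebra over a field) of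
dimension `4`, `char k = 3` ⇒ (F1) (`charHypothesis_of_dim_four_char_three`).  NOT proved here; NOT a
statement of [CJS 2020].  (OURS row — parameterless `Prop`, deliberately untagged so that the gate does not
relocate it to `Literature/`, precedent W4.2 `MovingLineageLocalizesM`; not asserted.) -/
def IsolatedConeTwoChainLocalizes : Prop :=
  ∀ (K : Type) [Field K] [CharP K 3] [DecidableEq K] (c : ℕ → State K),
    (∀ k, IsIsolated 3 (c k).F ∧ Step0 3 (c k) (c (k + 1)) ∧ ordZero (c k).F = (3 : ℕ∞) ∧ ebar (c k).F = 2) →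
    ∃ (N : ℕ) (S B : ℕ → Scheme.{0}) (hS : ∀ i, IsLocallyNoetherian (S i)) (hB : ∀ i, IsLocallyNoetherian (B i))
      (π : ∀ i, B i ⟶ S i) (pt : ∀ i, ↥(S i)) (b : ∀ i, ↥(B i)) (hcl : ∀ i, IsClosed ({pt i} : Set (S i))),
      (∀ i, IsBlowup (π i) (vanishingIdeal ⟨{pt i}, hcl i⟩)) ∧ (∀ i, (π i).base (b i) = pt i) ∧
      (∀ i, IsClosed ({b i} : Set (B i))) ∧
      (∀ i, Scheme.hsFun (B i) N (b i) = Scheme.hsFun (S i) N (pt i)) ∧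
      (∀ i, IsLocalSchemeAt (S (i + 1)) (pt (i + 1)) (B i) (b i)) ∧ IsLocalAt (S 0) (pt 0) ∧
      Scheme.IsExcellent (S 0) ∧ topologicalKrullDim ↥(S 0) ≤ (N : WithBot ℕ∞) ∧ CharHypothesis (S 0) (pt 0) ∧
      (∀ i, IdealSheafData.IsPermissible (vanishingIdeal (⟨{pt i}, hcl i⟩ : Closeds (S i)))) ∧
      (∀ i, @Scheme.dirDim (S i) (hS i) (pt i) = 2) ∧ (∀ i, @Scheme.geomDirDim (S i) (hS i) (pt i) = 2) ∧
      (∀ i, @Scheme.dirDim (B i) (hB i) (b i) = 2) ∧ (∀ i, @Scheme.geomDirDim (B i) (hB i) (b i) = 2) ∧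
      (∀ i, @IsIsolatedInHSMaxLocus (S i) (hS i) N (pt i))

/-! ## §3 The assembly: F4-I(3,3) from CJS Thm. 6.40 modulo the transfer row -/

/-- **`E2(3,3)` FROM COSSART–JANNSEN–SAITO, MODULO THE TRANSFER ROW.**  If CJS LNM 2270 Thm. 6.40 holds
in its unit-wise localised isolated form (the tree's named fact `KeyTheorem640_char_localized_isolated`,
[DIM4 · CJS-ROW]) and every E2-violating frame chain localises (`IsolatedConeTwoChainLocalizes`, OURS), then
`NoWideTrap 3 3`: an infinite isolated `Step0 3` chain on the `e = ē = 2` cone would localise to an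
infinite unit-wise localised chain of length-one fundamental units with isolated initial parts
(`LocalChains.false_of_units_chain`), which Thm. 6.40 forbids. [OURS · conditional assembly]
[cite: CossartJannsenSaito2020, Thm. 6.40, Def. 6.38, Def. 6.39, p. 107] -/
theorem noWideTrap_three_of_CJS (hK640 : KeyTheorem640_char_localized_isolated.{0})
    (hT : IsolatedConeTwoChainLocalizes) : NoWideTrap 3 3 := by
  haveI : Fact (Nat.Prime 3) := ⟨Nat.prime_three⟩
  rw [noWideTrap_iff_coneTwo]
  intro K _ _ _
  rintro ⟨c, hc⟩
  obtain ⟨N, S, B, hS, hB, π, pt, b, hcl, hπ, hb, hbcl, hH, hS', hloc, hexc, hdim, hchar, hperm, he, hē, heB,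
    hēB, hiso⟩ := hT K c hc
  exact @false_of_units_chain hK640 N S B hS hB π pt b hcl hπ hb hbcl hH hS' hloc hexc hdim hchar hperm he hē
    heB hēB hiso

/-- **F4-I(3,3) FROM COSSART–JANNSEN–SAITO, MODULO THE TRANSFER ROW**: `NoIsolatedTrap 3 3` from the named
fact `KeyTheorem640_char_localized_isolated` and the OURS row `IsolatedConeTwoChainLocalizes`, through
res-dim4-p-12's `noIsolatedTrap_three_three_iff_noWideTrap` (p661515: FT(3,3) + K2(3) discharge every branch
but the wide floor trap). [OURS · conditional assembly] [cite: CossartJannsenSaito2020, Thm. 6.40] -/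
theorem noIsolatedTrap_three_three_of_CJS (hK640 : KeyTheorem640_char_localized_isolated.{0})
    (hT : IsolatedConeTwoChainLocalizes) : NoIsolatedTrap 3 3 :=
  noIsolatedTrap_three_three_iff_noWideTrap.mpr (noWideTrap_three_of_CJS hK640 hT)

end E2OfCJS

end Summit.ResolutionOfSingularities.ResolutionOfSingularities.Theorems.PIDim4

end
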